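import Literature.MathematicalPhysics.QuantumFieldTheory.Balaban1983to89.B8LeafModelZdSockP5uE

/-!
# `Balaban1983to89.B8LeafModelZdSockP5uEGamma` — [Balaban1985RegularSpaces] PROPOSITION 5 (p. 94), UNIQUENESS CLAUSE (1.109): THE REPAIRED SOCKET
# `SockP5uE` OF THE N05 KNIT WITH ITS (1.35) ANTECEDENT IN PRINT's p. 77 BOND CONVENTION — EDITION γ `SockP5uEγ` (the text a provider over print's
# crossing-bond class (1.31) can conclude)

statement-level skeleton of published theorems with citation tags; nothing here is a claim about the Yang–Mills mass gap

T. Bałaban, *Spaces of regular gauge field configurations on a lattice and gauge fixing conditions*, Commun. Math. Phys. **99** (1985) 75–102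
`[Balaban1985RegularSpaces]` ("B8"; printed page = PDF page + 74): Prop. 5 (1.107)–(1.109) p. 94, Thm 4 p. 88 and p. 95 (the uniqueness paragraph),
(1.31) + (1.35) p. 82, p. 77 «Let us mention that if Ω is a subset of the lattice, then Ω also denotes the set of bonds … at least one end-point of b
belongs to Ω».  PDF held: `paper:balaban1985-cmp99-regular-spaces-gauge-fixing`.  STATUS: published, refereed.

CITATION HEADER (lean-in-tree rule).  Cell `pub-ymgap` (YM Track A, DAG node N05 = [B8], HUMAN RULING D-0062 ∕ D-0149 width seats), seat
`pub-ymgap-dag-n05-w4` (g0); the socket family `B8LeafModelZd*` is dag-n05-a's (g4∕g7; parked since 2026-08-26) — this file ADDS one text, it edits none.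
WHY THIS FILE (LOCATED-SOCK135, this seat, cell bus 2026-08-27).  The repaired uniqueness socket `B8LeafModelZdSockP5uE.SockP5uE` (dag-n04-b's text, adopted
by the owner) states the datum's (1.35)∕(1.66) closeness as «for every level-`j` bond whose locality box `B^j(c₋) ∪ B^j(c₊)` lies in `Ω_j`,
`‖Ū′U₀ʲ(c) − Ū₀ʲ(c)‖ ≤ α₁`».  After dag-n05-c's shell-mode certificates (`B8Ineq159FlatShellModeVacuity` p572834, `B8SockB9P3ShellModeVacuityUniv` p576185)
the b9 socket of the knit is read over print's bond class (1.31), which contains the CROSSING bonds of every level `j ≥ 1` — bonds whose box lies in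
`Ω_{j−1}` but not in `Ω_j` —, and the provider's (1.42) step (dag-n05-e `B8Eq142KLevelLocalGamma.H42_of_inAx_γ`) needs (1.35) AT those bonds.  The text
`SockP5uE` supplies (1.35) only under «box ⊂ Ω_j», so no provider in edition γ can conclude it as it stands.  THIS FILE types the edition γ of the text:
★ `SockP5uEγ` = `SockP5uE` VERBATIM except that the (1.35) antecedent is guarded by «box ⊂ Ω_{j−1}» (ℕ subtraction; level 0 reads `Ω₀`) — print's
p. 77 convention, under which (1.35) p. 82 is stated for all bonds with at least one end-point in `Ω_j`.  Since `Ω` is antitone the γ text asks MORE of the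
datum, i.e. it is the WEAKER socket: `sockP5uEγ_of_sockP5uE`.  The Theorem-4 consumer in edition γ (dag-n05-e's driver `B8Thm4KLevelGamma`) displays (1.35)
in exactly this guard and can feed it; the provider is this seat's `B8SockP5uEAssemblyBGamma` ∕ `B8SockP5uEProviderGamma`.
Kind «definition»: one `def` (a `Prop`-valued socket = a HYPOTHESIS SHAPE of the knit) + two bookkeeping theorems.

HONEST SCOPE ∕ A6.  Nothing of Proposition 5 is asserted or proved here.  The socket is a hypothesis shape; its providers take the b9 socket ([4] Thm 3.3
over print's class; inhabited at `m = 0` by dag-n06-b's witness, N06 content at `m ≥ 1`) and the [4]-letters family as hypotheses.  Count-neutral; N05 NOT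
discharged; no count claim; one finite `𝕋⁴` programme at fixed `ε`, Bałaban as printed; the Yang–Mills mass gap (Clay) is NOT proved by any of this — R4
closes the conditional finite-`𝕋⁴` rung `BalabanLadder.UV` only; nothing continuum ∕ ℝ⁴ ∕ OS.  No `sorry`, no `instance`, no `notation`.
Unit `pub-ymgap-dag-n05-w4` (g0), 2026-08-27.

RELATED IN THE TREE, NOT DUPLICATED: `B8LeafModelZdSockP5uE.SockP5uE` (dag-n05-a∕dag-n04-b; the «box ⊂ Ω_j» text — cited, implied-by relation proved
below), `B8LeafModelZd.SockP5u` (g4 text, superseded by `SockP5uE`), `B8Thm4UniqueE` ∕ `B8Thm4ConcreteE` (dag-n05-a; consumers of `SockP5uE`),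
`B8SockP5uEAssembly(B)` (dag-n04-b ∕ dag-n05-d; providers of `SockP5uE` modulo the b9 socket over a «box ⊂ Ω_j» class).
-/

noncomputable section

namespace Literature.MathematicalPhysics.QuantumFieldTheory.Balaban1983to89.B8LeafModelZdSockP5uEGamma

open B7Prop1Explicit B7Prop2Explicit B7Prop1Local B7Eq92Concrete
open B8Ineq132 (covDerivFwd InAk)
open B8Eq119TwistedAxial (Restr129 InAx)
open B8Eq184Proof (gaugeExp cfgExp)
open B8Lemma1NonAbelian (mulCfg)
open B8Eq140Level (SideTouches)
open B8Eq138LandauZd (IsLandau138W)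
open B8LeafModelZdSockP5uE (SockP5uE)

variable {d : ℕ} {𝔸 : Type*} [CStarAlgebra 𝔸] [Nontrivial 𝔸]

/-- ★ **The Proposition-5 UNIQUENESS socket, repaired, EDITION γ** — `B8LeafModelZdSockP5uE.SockP5uE` ((1.109) p. 94 for the PRINTED datum
`U₁ = U′^{u₁⁻¹}` in the Landau gauge of record with the (1.36)∕(1.62)-shape at `c⋆ = 5dLB₀(α₀ + α₁)`, `u₁` carried by `Ω₀` with (1.29); competitors
`v = e^{iλ}`, `w = e^{iμ}` carried by `Ω₀` in print's domain «|λ|, |Dλ|₍₋₁₎ < c_u»; conclusion `v = w`) VERBATIM, except that the guard's (1.35)∕(1.66)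
antecedent is stated for every level-`j` bond whose locality box `B^j(c₋) ∪ B^j(c₊)` lies in `Ω_{j−1}` (print's p. 77 convention «at least one end-point
in Ω_j» includes the crossing bonds of (1.31); ℕ subtraction, so level 0 reads `Ω₀`).
[cite: Balaban1985RegularSpaces, Prop. 5 (1.109) p.94, (1.107)–(1.108) p.94, (1.35) + (1.31) p.82, p.77, (1.36)–(1.38) p.82, (1.62) p.87, (1.29) p.81] -/
def SockP5uEγ (L : ℕ) (B₀ cP cu : ℝ) (η : ℝ) (k : ℕ) (Ω : ℕ → Set (B7Prop1Explicit.Site d))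
    (Λs : ℕ → ℕ → Set (B7Prop1Explicit.Site d)) : Prop :=
  ∀ α₀ α₁ : ℝ, 0 < α₀ → 0 < α₁ → α₀ + α₁ ≤ cP →
      ∀ U₀ U' : B7Prop1Explicit.Site d → Fin d → 𝔸ˣ, (∀ x κ, U₀ x κ ∈ unitaryUnits 𝔸) → (∀ x κ, U' x κ ∈ unitaryUnits 𝔸) →
      InAk L k η α₀ Ω U₀ → InAk L k η α₀ Ω (mulCfg U' U₀) → (∀ m, m ≤ k → InAx L m (Λs m) U₀ (mulCfg U' U₀)) →
      (∀ j, j ≤ k → ∀ (z : B7Prop1Explicit.Site d) (μ : Fin d), (∀ x, InBox (loK L j z) (bondHiK L j z μ) x → x ∈ Ω (j - 1)) →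
        ‖(avgIter L (mulCfg U' U₀) j z μ : 𝔸) - (avgIter L U₀ j z μ : 𝔸)‖ ≤ α₁) →
      (∀ b ∈ {b : B7Prop1Explicit.Site d × Fin d | SideTouches (Ω 0) b.1 b.2}, ‖((U' b.1 b.2 : 𝔸ˣ) : 𝔸) - 1‖ ≤ α₁) →
      ∀ u₁ : B7Prop1Explicit.Site d → 𝔸ˣ, (∀ x, u₁ x ∈ unitaryUnits 𝔸) → (∀ x, x ∉ Ω 0 → u₁ x = 1) → Restr129 L k (Λs k) U₀ u₁ →
      IsLandau138W L k η (Ω 0) (Λs k) U₀ (mgauge U₀ u₁⁻¹ U') →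
      (∃ A₁ : B7Prop1Explicit.Site d → Fin d → 𝔸, ∀ j, j ≤ k → ∀ (x : B7Prop1Explicit.Site d) (κ : Fin d), SideTouches (Ω j) x κ →
        mgauge U₀ u₁⁻¹ U' x κ = cfgExp η A₁ x κ ∧ ‖A₁ x κ‖ ≤ (5 * (d : ℝ) * L * B₀ * (α₀ + α₁)) * ((L : ℝ) ^ j * η)⁻¹) →
      ∀ (v w : B7Prop1Explicit.Site d → 𝔸ˣ) (lam mu : B7Prop1Explicit.Site d → 𝔸),
      (∀ x, ((gaugeExp lam x : 𝔸ˣ) : 𝔸) = ((v x : 𝔸ˣ) : 𝔸) ∧ IsSelfAdjoint (lam x) ∧ ‖lam x‖ < cu) → (∀ x, x ∉ Ω 0 → lam x = 0) →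
      (∀ j, j ≤ k → ∀ b ∈ {b : B7Prop1Explicit.Site d × Fin d | SideTouches (Ω j) b.1 b.2},
        ((L : ℝ) ^ j * η) * ‖covDerivFwd η U₀ b.2 lam b.1‖ < cu) →
      (∀ x, ((gaugeExp mu x : 𝔸ˣ) : 𝔸) = ((w x : 𝔸ˣ) : 𝔸) ∧ IsSelfAdjoint (mu x) ∧ ‖mu x‖ < cu) → (∀ x, x ∉ Ω 0 → mu x = 0) →
      (∀ j, j ≤ k → ∀ b ∈ {b : B7Prop1Explicit.Site d × Fin d | SideTouches (Ω j) b.1 b.2},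
        ((L : ℝ) ^ j * η) * ‖covDerivFwd η U₀ b.2 mu b.1‖ < cu) →
      IsLandau138W L k η (Ω 0) (Λs k) U₀ (mgauge U₀ v⁻¹ (mgauge U₀ u₁⁻¹ U')) → Restr129 L k (Λs k) U₀ (u₁ * v) →
      IsLandau138W L k η (Ω 0) (Λs k) U₀ (mgauge U₀ w⁻¹ (mgauge U₀ u₁⁻¹ U')) → Restr129 L k (Λs k) U₀ (u₁ * w) →
      ∀ x, v x = w x

omit [Nontrivial 𝔸] in
/-- **`SockP5uE → SockP5uEγ`** along an antitone region sequence `Ω_{j+1} ⊆ Ω_j`: a bond whose box lies in `Ω_j` has its box in `Ω_{j−1}`, so the γ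
text's (1.35) antecedent implies the old one — the γ socket asks more of the datum and is the WEAKER hypothesis of the knit.
[cite: Balaban1985RegularSpaces, (1.35) p.82, p.77, (1.3) p.77] -/
theorem sockP5uEγ_of_sockP5uE {L : ℕ} {B₀ cP cu η : ℝ} {k : ℕ} {Ω : ℕ → Set (B7Prop1Explicit.Site d)}
    {Λs : ℕ → ℕ → Set (B7Prop1Explicit.Site d)} (hΩ : ∀ j, Ω (j + 1) ⊆ Ω j)
    (S : SockP5uE (𝔸 := 𝔸) L B₀ cP cu η k Ω Λs) : SockP5uEγ (𝔸 := 𝔸) L B₀ cP cu η k Ω Λs := by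
  intro α₀ α₁ hα₀ hα₁ hs U₀ U' hU₀ hU' h33 h34 hAx h135 h66
  -- `Ω_j ⊆ Ω_{j−1}` (ℕ subtraction)
  have hΩp : ∀ j, Ω j ⊆ Ω (j - 1) := by
    intro j x hx
    rcases Nat.eq_zero_or_pos j with rfl | hjp
    · simpa using hx
    · obtain ⟨i, rfl⟩ : ∃ i, j = i + 1 := ⟨j - 1, by omega⟩
      rw [Nat.add_sub_cancel]; exact hΩ i hx
  exact S α₀ α₁ hα₀ hα₁ hs U₀ U' hU₀ hU' h33 h34 hAx
    (fun j hj z μ hbox => h135 j hj z μ fun x hx => hΩp j (hbox x hx)) h66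

omit [Nontrivial 𝔸] in
/-- `SockP5uEγ` is antitone in the threshold `c_P` and monotone-down in the radius `c_u` (a smaller threshold admits fewer data; a smaller radius
admits fewer competitors). [cite: Balaban1985RegularSpaces, Prop. 5 (1.109) p.94 («c₂, c₃»)] -/
theorem sockP5uEγ_mono {L : ℕ} {B₀ cP cP' cu cu' η : ℝ} {k : ℕ} {Ω : ℕ → Set (B7Prop1Explicit.Site d)}
    {Λs : ℕ → ℕ → Set (B7Prop1Explicit.Site d)} (hP : cP' ≤ cP) (hu : cu' ≤ cu)
    (S : SockP5uEγ (𝔸 := 𝔸) L B₀ cP cu η k Ω Λs) : SockP5uEγ (𝔸 := 𝔸) L B₀ cP' cu' η k Ω Λs := by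
  intro α₀ α₁ hα₀ hα₁ hs U₀ U' hU₀ hU' h33 h34 hAx h135 h66 u₁ hu₁ hu₁0 h129 hLan hdat v w lam mu hv hv0 hvD hw hw0 hwD
  exact S α₀ α₁ hα₀ hα₁ (hs.trans hP) U₀ U' hU₀ hU' h33 h34 hAx h135 h66 u₁ hu₁ hu₁0 h129 hLan hdat v w lam mu
    (fun x => ⟨(hv x).1, (hv x).2.1, (hv x).2.2.trans_le hu⟩) hv0 (fun j hj b hb => (hvD j hj b hb).trans_le hu)
    (fun x => ⟨(hw x).1, (hw x).2.1, (hw x).2.2.trans_le hu⟩) hw0 (fun j hj b hb => (hwD j hj b hb).trans_le hu)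

end Literature.MathematicalPhysics.QuantumFieldTheory.Balaban1983to89.B8LeafModelZdSockP5uEGamma

end
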